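import Summits.NavierStokesRegularity.FunctionalMining.TopEigTransportSelection
import Summits.NavierStokesRegularity.FunctionalMining.NoGo.TopEigSaturatingKillBot
import HarnessLib

/-!
# FunctionalMining — the transport identity for the `−λ₃` weight: the bottom selection production
# of the static door has no transport term

Search for candidate a priori estimates; no regularity claim. Cell `pub-nsfunc`, prove seat
(gen 24). The `−λ₃` mirror of `TopEigTransportSelection` §7 for the rows `ES.neglam3.q | T_LD`
(`NoGo/TopEigSaturatingKillBot`): with `−S(w) = S(−w)`, `−λ₃(w) = λ₁(−w)` and
`∂ₖS(−w) = −∂ₖS(w)`, LEMMA ADV at the field `v = −w` transported by `w` gives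

* `TopEig.partialDeriv_strainFlat_neg` — `∂ₖS(−w) = −∂ₖS(w)`;
* `TopEig.integral_negBotEigWeight_quad_transport_eq_zero` — for smooth divergence-free `w`,
  `q ≥ 1` and ANY field `e` of unit top vectors of `−S(w)` (a.e.):
  `∫ q(−λ₃)^{q−1} e(x)ᵀ(Σₖ wₖ(x) ∂ₖS(w)(x)) e(x) dx = 0`;
* **`TopEig.selEulerProductionBot_eq_integral_hessian`** — `𝒫̃_q(w; e) = ∫ q(−λ₃)^{q−1}
  eᵀ(Π(π_w) + N(w))e` for every field `e` of unit top vectors of `−S(w)` (every heat-maximal bottom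
  selection in particular), whether or not the Hessian density is integrable; and
  `TopEig.integrable_selEulerBotDensity_iff` — the door's integrability hypothesis is the
  integrability of this Hessian density.

Refutation bookkeeping for CANDIDATE a priori inequalities; nothing here is about Navier–Stokes
regularity; no instance of the door `NegBotEigSelKillAt` is proved. [ours; Danskin folklore]
-/

noncomputable section

open MeasureTheory Set Filter Topology

namespace Summit.NavierStokesRegularity.FunctionalMining

open Literature.Analysis.FunctionSpaces Literature.Analysis.FluidPDE

namespace TopEig

open StrainL4 StrainTensor

variable {d : Type*} [Fintype d] [DecidableEq d] [Nonempty d]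
variable {q : ℝ} {w : UnitAddTorus d → EuclideanSpace ℝ d}

omit [Nonempty d] in
/-- `∂ₖS(−w) = −∂ₖS(w)`. [ours] -/
theorem partialDeriv_strainFlat_neg (w : UnitAddTorus d → EuclideanSpace ℝ d) (k : d)
    (x : UnitAddTorus d) :
    Torus.partialDeriv k (strainFlat (-w)) x = -Torus.partialDeriv k (strainFlat w) x := by
  have h : strainFlat (-w) = fun y => -strainFlat w y := funext fun y => strainFlat_neg w y
  rw [h, Torus.partialDeriv_neg]

omit [Nonempty d] in
/-- The transport of `−S(w)` by `w`, written with the strain of `−w`: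
`Σₖ wₖ ∂ₖS(−w) = −Σₖ wₖ ∂ₖS(w)`. [ours] -/
theorem transport_strainFlat_neg (w : UnitAddTorus d → EuclideanSpace ℝ d) (x : UnitAddTorus d) :
    ∑ k, w x k • Torus.partialDeriv k (strainFlat (-w)) x =
      -∑ k, w x k • Torus.partialDeriv k (strainFlat w) x := by
  rw [← Finset.sum_neg_distrib]
  exact Finset.sum_congr rfl fun k _ => by rw [partialDeriv_strainFlat_neg, smul_neg]

/-- **LEMMA ADV for the `−λ₃` weight.** For smooth divergence-free `w` on `T^d`, `q ≥ 1` and ANY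
field `e` with `e(x)` a unit top vector of `−S(w)(x)` for a.e. `x`:
`∫ q(−λ₃)^{q−1} e(x)ᵀ(Σₖ wₖ(x) ∂ₖS(w)(x)) e(x) dx = 0` (LEMMA ADV at `v = −w`, transported by
`w`). [ours] -/
theorem integral_negBotEigWeight_quad_transport_eq_zero (hq : 1 ≤ q) (hw : Torus.IsSmooth w)
    (hdw : Torus.IsDivFree w) {e : UnitAddTorus d → d → ℝ}
    (he : ∀ᵐ x : UnitAddTorus d, e x ∈ topEigSet (-strainFlat w x)) :
    ∫ x, q * (-torusStrainBotEig w x) ^ (q - 1) *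
      quad (∑ k, w x k • Torus.partialDeriv k (strainFlat w) x) (e x) = 0 := by
  have he' : ∀ᵐ x : UnitAddTorus d, e x ∈ topEigSet (strainFlat (-w) x) := by
    filter_upwards [he] with x hx
    rwa [strainFlat_neg]
  have h := integral_topEigWeight_quad_transport_eq_zero hq hw.neg ((torus_isDivFree_neg_iff w).2 hdw)
    hw hdw he'
  have hpt : ∀ x, q * torusStrainTopEig (-w) x ^ (q - 1) *
      quad (∑ k, w x k • Torus.partialDeriv k (strainFlat (-w)) x) (e x) =
      -(q * (-torusStrainBotEig w x) ^ (q - 1) *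
        quad (∑ k, w x k • Torus.partialDeriv k (strainFlat w) x) (e x)) := fun x => by
    rw [torusStrainTopEig_neg, transport_strainFlat_neg,
      ← neg_one_smul ℝ (∑ k, w x k • Torus.partialDeriv k (strainFlat w) x), quad_smul]
    ring
  simp only [hpt, integral_neg, neg_eq_zero] at h
  exact h

/-- **`𝒫̃_q(w; e) = ∫ q(−λ₃)^{q−1} eᵀ(Π(π_w) + N(w))e`** for smooth divergence-free `w` on `T^d`,
`q ≥ 1` and ANY field `e` of unit top vectors of `−S(w)` (every heat-maximal bottom selection in
particular): the transport part of `−E_w` integrates to zero through `e`, whether or not the Hessian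
density is integrable. Refutation bookkeeping for a CANDIDATE inequality; nothing about regularity.
[ours] -/
theorem selEulerProductionBot_eq_integral_hessian (hq : 1 ≤ q) (hw : Torus.IsSmooth w)
    (hdw : Torus.IsDivFree w) {e : UnitAddTorus d → d → ℝ}
    (he : ∀ x, e x ∈ topEigSet (-strainFlat w x)) :
    selEulerProductionBot q w e = ∫ x, q * (-torusStrainBotEig w x) ^ (q - 1) *
      quad (pressVec (pressureOf w) x + nonlinVec w x) (e x) := by
  have hv : Torus.IsSmooth (-w) := hw.neg
  have hdv : Torus.IsDivFree (-w) := (torus_isDivFree_neg_iff w).2 hdw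
  have he' : ∀ x, e x ∈ topEigSet (strainFlat (-w) x) := fun x => by
    rw [strainFlat_neg]; exact he x
  have hτ_ae := ae_topEigWeight_quad_transport_eq hq hv hdv (fun x k => w x k)
  -- the transport density through `e`, written with the strain of `−w`, is integrable
  have hτ_int : Integrable (fun x => q * torusStrainTopEig (-w) x ^ (q - 1) *
      quad (∑ k, w x k • Torus.partialDeriv k (strainFlat (-w)) x) (e x)) volume := by
    have hS := isSmooth_strainFlat hv
    have h1 : Integrable (fun x => ∑ k, w x k * (q * torusStrainTopEig (-w) x ^ (q - 1) *
        dirTopEig (strainFlat (-w) x) (Torus.partialDeriv k (strainFlat (-w)) x))) volume :=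
      integrable_finsetSum _ fun k _ => integrable_continuous_mul (hw.apply k).continuous
        (integrable_topEigDensity hq hv hdv (hS.partialDeriv k).continuous)
    refine h1.congr ?_
    filter_upwards [hτ_ae] with x hx
    exact (hx (e x) (he' x)).symm
  have hτ0 : ∫ x, q * torusStrainTopEig (-w) x ^ (q - 1) *
      quad (∑ k, w x k • Torus.partialDeriv k (strainFlat (-w)) x) (e x) = 0 :=
    integral_topEigWeight_quad_transport_eq_zero hq hv hdv hw hdw (e := e) (ae_of_all _ he')
  have hsplit : ∀ x, q * (-torusStrainBotEig w x) ^ (q - 1) * quad (-eulerStrainVec w x) (e x) =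
      q * (-torusStrainBotEig w x) ^ (q - 1) * quad (pressVec (pressureOf w) x + nonlinVec w x) (e x) -
      q * torusStrainTopEig (-w) x ^ (q - 1) *
        quad (∑ k, w x k • Torus.partialDeriv k (strainFlat (-w)) x) (e x) := fun x => by
    rw [torusStrainTopEig_neg, transport_strainFlat_neg, ← mul_sub, ← quad_sub]
    congr 2
    rw [eulerStrainVec]
    abel
  unfold selEulerProductionBot
  simp only [hsplit]
  by_cases hH : Integrable (fun x => q * (-torusStrainBotEig w x) ^ (q - 1) *
      quad (pressVec (pressureOf w) x + nonlinVec w x) (e x)) volume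
  · rw [integral_sub hH hτ_int, hτ0, sub_zero]
  · have hH' : ¬ Integrable (fun x => q * (-torusStrainBotEig w x) ^ (q - 1) *
        quad (pressVec (pressureOf w) x + nonlinVec w x) (e x) -
        q * torusStrainTopEig (-w) x ^ (q - 1) *
        quad (∑ k, w x k • Torus.partialDeriv k (strainFlat (-w)) x) (e x)) volume := fun h =>
      hH ((h.add hτ_int).congr (ae_of_all _ fun x => by simp only [Pi.add_apply, sub_add_cancel]))
    rw [integral_undef hH, integral_undef hH']

/-- **The bottom door's integrability hypothesis is the integrability of the Hessian density**:
for smooth divergence-free `w`, `q ≥ 1` and any field `e` of unit top vectors of `−S(w)`,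
`x ↦ q(−λ₃)^{q−1} eᵀ(−E_w)e` is integrable iff `x ↦ q(−λ₃)^{q−1} eᵀ(Π(π_w) + N(w))e` is. [ours] -/
theorem integrable_selEulerBotDensity_iff (hq : 1 ≤ q) (hw : Torus.IsSmooth w)
    (hdw : Torus.IsDivFree w) {e : UnitAddTorus d → d → ℝ}
    (he : ∀ x, e x ∈ topEigSet (-strainFlat w x)) :
    Integrable (fun x => q * (-torusStrainBotEig w x) ^ (q - 1) *
      quad (-eulerStrainVec w x) (e x)) volume ↔
      Integrable (fun x => q * (-torusStrainBotEig w x) ^ (q - 1) *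
        quad (pressVec (pressureOf w) x + nonlinVec w x) (e x)) volume := by
  have hv : Torus.IsSmooth (-w) := hw.neg
  have hdv : Torus.IsDivFree (-w) := (torus_isDivFree_neg_iff w).2 hdw
  have he' : ∀ x, e x ∈ topEigSet (strainFlat (-w) x) := fun x => by
    rw [strainFlat_neg]; exact he x
  have hτ_ae := ae_topEigWeight_quad_transport_eq hq hv hdv (fun x k => w x k)
  have hτ_int : Integrable (fun x => q * torusStrainTopEig (-w) x ^ (q - 1) *
      quad (∑ k, w x k • Torus.partialDeriv k (strainFlat (-w)) x) (e x)) volume := by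
    have hS := isSmooth_strainFlat hv
    have h1 : Integrable (fun x => ∑ k, w x k * (q * torusStrainTopEig (-w) x ^ (q - 1) *
        dirTopEig (strainFlat (-w) x) (Torus.partialDeriv k (strainFlat (-w)) x))) volume :=
      integrable_finsetSum _ fun k _ => integrable_continuous_mul (hw.apply k).continuous
        (integrable_topEigDensity hq hv hdv (hS.partialDeriv k).continuous)
    refine h1.congr ?_
    filter_upwards [hτ_ae] with x hx
    exact (hx (e x) (he' x)).symm
  have hsplit : (fun x => q * (-torusStrainBotEig w x) ^ (q - 1) * quad (-eulerStrainVec w x) (e x)) =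
      fun x => q * (-torusStrainBotEig w x) ^ (q - 1) *
        quad (pressVec (pressureOf w) x + nonlinVec w x) (e x) -
      q * torusStrainTopEig (-w) x ^ (q - 1) *
        quad (∑ k, w x k • Torus.partialDeriv k (strainFlat (-w)) x) (e x) := by
    funext x
    rw [torusStrainTopEig_neg, transport_strainFlat_neg, ← mul_sub, ← quad_sub]
    congr 2
    rw [eulerStrainVec]
    abel
  rw [hsplit]
  constructor
  · intro h
    exact (h.add hτ_int).congr (ae_of_all _ fun x => by simp only [Pi.add_apply, sub_add_cancel])
  · intro h; exact h.sub hτ_int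

end TopEig

end Summit.NavierStokesRegularity.FunctionalMining

end
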